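import Mathlib
import HarnessLib

/-!
# The Lebesgue volume of the cone over a subset of `ℍ` in `M₂(ℝ)⁺`:
# `vol {x : 0 < det x ≤ T, x·i ∈ S} = (π T² / 2) · μ(S)`

Topic `NumberTheory/Automorphic`; theorems only (no definition, no named fact, no instance).
The real `2 × 2` matrices of positive determinant act on the upper half plane, and
`x ↦ (det x, x • i, k)` (`x = √(det x) · g_{x•i} · k`, `k ∈ SO₂`, the Iwasawa decomposition)
identifies `GL₂(ℝ)⁺` with `ℝ_{>0} × ℍ × SO₂`. In these coordinates the Lebesgue measure of
`M₂(ℝ) ≅ ℝ⁴` (the four entries) is `½ · dt · dμ(z) · dθ`, `μ = dx dy / y²` the hyperbolic measure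
(Mathlib's `volume` on `ℍ`) and `θ ∈ [0, 2π)` the angle of `k`. Consequently, for a measurable
`S ⊆ ℍ` and `T ≥ 0`, the cone `{x : 0 < det x ≤ T, x • i ∈ S}` has Lebesgue volume

  `vol = ½ · T²/2 · 2π · μ(S) = (π T² / 2) · μ(S)`   (`volume_cone_eq`),

and the full cone `{x : 0 < det x, x • i ∈ S}` over a `μ`-null set is Lebesgue-null
(`volume_cone_eq_zero_of_null`). This is the Jacobian at the heart of Eichler's lattice-point
method for the covolume of the unit group of a quaternion order (Eichler 1938/1955; Shimizu 1963
§§2–3; Vignéras, *Arithmétique des algèbres de quaternions*, Ch. IV §1 (mesures de Tamagawa,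
`dx = |det x|⁻² ∏ dx_{ij}` on `GL₂(ℝ)`) and §3.A): counting the points of the lattice `ι(O)` in this
cone compares `#{α ∈ O : 0 < nrd α ≤ T} / O¹` with `μ(Γ \ ℍ) / covol(ι(O))`. Brick "S3b" of the
`D > 1` branch of the proof of
`Literature.NumberTheory.Automorphic.ShimuraCurveData.volume_fd_eq`.

Proof (no Jacobians of non-linear maps are needed): read the two ROWS of `x` as complex numbers
`r = a + bi`, `w = c + di`. Then `det x = Im(r̄ w)` and `x • i = (ai + b)/(ci + d) = \overline{r/w}`,
and for fixed `w ≠ 0` the row `r` is recovered from `z = x • i` by the `ℝ`-linear map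
`z ↦ r = w z̄` of determinant `-|w|²`, under which `det x = |w|² Im z`. Hence, by Fubini over the
rows and the linear change of variables in the first row,
`vol = ∫_w |w|² · Leb{z ∈ S : |w|² Im z ≤ T} dw = ∫_{z ∈ S} (∫_{|w|² ≤ T / Im z} |w|² dw) dx dy`
`= ∫_{z ∈ S} π T² / (2 (Im z)²) dx dy = (π T²/2) μ(S)` (polar coordinates for the inner integral,
Mathlib `Complex.lintegral_comp_polarCoord_symm`).

The cone is handed over as a hypothesis `hC : ∀ x, x ∈ C ↔ ∃ g : GL (Fin 2) ℝ, …` (entries of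
`g` = entries of `x`, `0 < det g ≤ T`, `g • i ∈ S`) so that users may phrase it with their own
set-builder expression.

## References

* M.-F. Vignéras, *Arithmétique des algèbres de quaternions*, LNM 800 (1980), Ch. IV §1, §3.A
  [VignerasLNM800].
* H. Shimizu, On discontinuous groups operating on the product of the upper half planes,
  Ann. of Math. 77 (1963) 33–71, §§2–3 [Shimizu1963].
-/

noncomputable section

open _root_.MeasureTheory _root_.MeasureTheory.Measure Complex Set
open scoped Real ENNReal ComplexConjugate MatrixGroups

namespace Literature.NumberTheory.Automorphic

/-! ### 1. `g • i = \overline{r / w}` and `det g = Im(r̄ w)` for the rows `r, w` of `g` -/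

/-- For `g ∈ GL₂(ℝ)⁺` with rows `r = a + bi`, `w = c + di` read as complex numbers,
`g • i = (ai + b)/(ci + d) = \overline{r / w}`. [folklore] -/
theorem coe_smul_I_eq_conj_div (g : GL (Fin 2) ℝ) (hg : 0 < g.det.val) :
    ((g • UpperHalfPlane.I : UpperHalfPlane) : ℂ) =
      conj ((⟨g 0 0, g 0 1⟩ : ℂ) / ⟨g 1 0, g 1 1⟩) := by
  rw [UpperHalfPlane.coe_smul_of_det_pos hg, map_div₀]
  have h1 : UpperHalfPlane.num g UpperHalfPlane.I = Complex.I * conj (⟨g 0 0, g 0 1⟩ : ℂ) := by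
    apply Complex.ext <;> simp [UpperHalfPlane.num]
  have h2 : UpperHalfPlane.denom g UpperHalfPlane.I = Complex.I * conj (⟨g 1 0, g 1 1⟩ : ℂ) := by
    apply Complex.ext <;> simp [UpperHalfPlane.denom]
  rw [h1, h2, mul_div_mul_left _ _ Complex.I_ne_zero]

/-- `det g = a d - b c = Im(r̄ w)` for the rows `r = a + bi`, `w = c + di`. [folklore] -/
theorem det_eq_im_conj_mul (g : GL (Fin 2) ℝ) :
    g.det.val = (conj (⟨g 0 0, g 0 1⟩ : ℂ) * ⟨g 1 0, g 1 1⟩).im := by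
  rw [Matrix.GeneralLinearGroup.val_det_apply, Matrix.det_fin_two]
  simp [Complex.mul_im]
  ring

/-! ### 2. The inner integral `∫_{|w|² v ≤ T} |w|² dw = π T² / (2 v²)` -/

/-- `∫_{0}^{ρ} r³ dr = ρ⁴ / 4` as a Lebesgue integral over `(0, ρ]`. [folklore] -/
theorem lintegral_Ioc_pow_three (ρ : ℝ) (hρ : 0 ≤ ρ) :
    ∫⁻ r in Ioc 0 ρ, ENNReal.ofReal (r ^ 3) = ENNReal.ofReal (ρ ^ 4 / 4) := by
  have hint : IntegrableOn (fun r : ℝ => r ^ 3) (Ioc 0 ρ) := (continuous_pow 3).integrableOn_Ioc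
  have hnn : 0 ≤ᵐ[volume.restrict (Ioc (0:ℝ) ρ)] fun r : ℝ => r ^ 3 :=
    ae_restrict_of_forall_mem measurableSet_Ioc fun r hr => pow_nonneg hr.1.le 3
  rw [← ofReal_integral_eq_lintegral_ofReal hint hnn, ← intervalIntegral.integral_of_le hρ,
    integral_pow]
  norm_num

/-- **`∫_{w ∈ ℂ : |w|² v ≤ T} |w|² dw = π T² / (2 v²)`** for `v > 0`, `T ≥ 0` (polar coordinates:
`2π ∫_0^{√(T/v)} r³ dr`). [folklore] -/
theorem lintegral_normSq_indicator (v T : ℝ) (hv : 0 < v) (hT : 0 ≤ T) :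
    ∫⁻ w : ℂ, {w : ℂ | Complex.normSq w * v ≤ T}.indicator (fun w => ENNReal.ofReal (Complex.normSq w)) w =
      ENNReal.ofReal (π * T ^ 2 / (2 * v ^ 2)) := by
  rw [← Complex.lintegral_comp_polarCoord_symm,
    show polarCoord.target = Ioi (0:ℝ) ×ˢ Ioo (-π) π from rfl]
  set ρ : ℝ := Real.sqrt (T / v) with hρ
  have hρ0 : 0 ≤ ρ := Real.sqrt_nonneg _
  have hρ2 : ρ ^ 2 = T / v := Real.sq_sqrt (div_nonneg hT hv.le)
  -- the integrand in polar coordinates only depends on the radius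
  set h : ℝ → ℝ≥0∞ := fun r => (Ioc 0 ρ).indicator (fun r => ENNReal.ofReal (r ^ 3)) r with hh
  have hmeas_h : Measurable h :=
    (ENNReal.measurable_ofReal.comp (measurable_id.pow_const 3)).indicator measurableSet_Ioc
  have hcongr : ∀ p ∈ Ioi (0:ℝ) ×ˢ Ioo (-π) π,
      ENNReal.ofReal p.1 • {w : ℂ | Complex.normSq w * v ≤ T}.indicator
        (fun w => ENNReal.ofReal (Complex.normSq w)) (Complex.polarCoord.symm p) = h p.1 * 1 := by
    rintro ⟨r, θ⟩ ⟨hr, -⟩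
    have hr' : (0:ℝ) < r := hr
    have hns : Complex.normSq (Complex.polarCoord.symm (r, θ)) = r ^ 2 := by
      rw [Complex.normSq_eq_norm_sq, Complex.norm_polarCoord_symm, abs_of_pos hr']
    simp only [smul_eq_mul, mul_one, hh, Set.indicator, Set.mem_setOf_eq, hns, Set.mem_Ioc]
    have hiff : r ^ 2 * v ≤ T ↔ r ≤ ρ := by
      rw [← le_div_iff₀ hv, ← hρ2]
      exact (pow_le_pow_iff_left₀ hr'.le hρ0 two_ne_zero)
    by_cases hle : r ≤ ρ
    · rw [if_pos (hiff.mpr hle), if_pos ⟨hr', hle⟩, ← ENNReal.ofReal_mul hr'.le]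
      ring_nf
    · rw [if_neg (fun h' => hle (hiff.mp h')), if_neg (fun h' => hle h'.2), mul_zero]
  rw [setLIntegral_congr_fun (measurableSet_Ioi.prod measurableSet_Ioo) hcongr,
    Measure.volume_eq_prod, ← Measure.prod_restrict,
    lintegral_prod_mul hmeas_h.aemeasurable measurable_const.aemeasurable, setLIntegral_one,
    Real.volume_Ioo]
  -- the radial integral
  have hrad : ∫⁻ r in Ioi (0:ℝ), h r = ENNReal.ofReal (ρ ^ 4 / 4) := by
    rw [hh, lintegral_indicator measurableSet_Ioc, Measure.restrict_restrict measurableSet_Ioc,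
      show Ioc (0:ℝ) ρ ∩ Ioi 0 = Ioc 0 ρ from Set.inter_eq_left.mpr fun r hr => hr.1]
    exact lintegral_Ioc_pow_three ρ hρ0
  rw [hrad, ← ENNReal.ofReal_mul (by positivity)]
  congr 1
  have : ρ ^ 4 = (T / v) ^ 2 := by rw [← hρ2]; ring
  rw [this]
  field_simp
  ring

/-! ### 3. The cone, in terms of the rows -/

/-- Reading a real `2 × 2` matrix `x` (rows `r = (a, b)`, `w = (c, d)` as complex numbers): there is
`g ∈ GL₂(ℝ)` with the entries of `x`, `det g > 0`, `p (det g)` and `g • i ∈ S` iff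
`δ = a d - b c = Im(r̄ w) > 0`, `p δ` and `\overline{r / w} ∈ S`. [folklore] -/
theorem exists_gl_entries_iff (x : Fin 2 → Fin 2 → ℝ) (p : ℝ → Prop) (S : Set UpperHalfPlane) :
    (∃ g : GL (Fin 2) ℝ, (∀ i j, g i j = x i j) ∧ 0 < g.det.val ∧ p g.det.val ∧
        g • UpperHalfPlane.I ∈ S) ↔
      0 < (conj (⟨x 0 0, x 0 1⟩ : ℂ) * ⟨x 1 0, x 1 1⟩).im ∧
        p (conj (⟨x 0 0, x 0 1⟩ : ℂ) * ⟨x 1 0, x 1 1⟩).im ∧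
        conj ((⟨x 0 0, x 0 1⟩ : ℂ) / ⟨x 1 0, x 1 1⟩) ∈ UpperHalfPlane.coe '' S := by
  constructor
  · rintro ⟨g, hg, hdet, hp, hS⟩
    have hd := det_eq_im_conj_mul g
    simp only [hg] at hd
    refine ⟨hd ▸ hdet, hd ▸ hp, ⟨g • UpperHalfPlane.I, hS, ?_⟩⟩
    rw [coe_smul_I_eq_conj_div g hdet]
    simp only [hg]
  · rintro ⟨hdet, hp, τ, hτ, hτeq⟩
    set A : Matrix (Fin 2) (Fin 2) ℝ := Matrix.of fun i j => x i j with hA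
    have hAdet : A.det = (conj (⟨x 0 0, x 0 1⟩ : ℂ) * ⟨x 1 0, x 1 1⟩).im := by
      rw [hA, Matrix.det_fin_two]
      simp [Complex.mul_im]
      ring
    set g : GL (Fin 2) ℝ := Matrix.GeneralLinearGroup.mkOfDetNeZero A (by rw [hAdet]; exact hdet.ne')
      with hg
    have hgij : ∀ i j, g i j = x i j := fun i j => rfl
    have hgdet : g.det.val = (conj (⟨x 0 0, x 0 1⟩ : ℂ) * ⟨x 1 0, x 1 1⟩).im := by
      rw [Matrix.GeneralLinearGroup.val_det_apply, ← hAdet]; rfl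
    refine ⟨g, hgij, hgdet ▸ hdet, hgdet ▸ hp, ?_⟩
    have : g • UpperHalfPlane.I = τ := by
      apply UpperHalfPlane.ext
      rw [coe_smul_I_eq_conj_div g (hgdet ▸ hdet), hτeq]
      rfl
    rw [this]
    exact hτ

/-- The two rows of `x`, read as a pair of complex numbers, depend measurably on `x`. [folklore] -/
theorem measurable_rows :
    Measurable fun x : Fin 2 → Fin 2 → ℝ => ((⟨x 0 0, x 0 1⟩ : ℂ), (⟨x 1 0, x 1 1⟩ : ℂ)) := by
  have h : ∀ i : Fin 2, Measurable fun x : Fin 2 → Fin 2 → ℝ => (⟨x i 0, x i 1⟩ : ℂ) := fun i =>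
    Complex.measurableEquivRealProd.symm.measurable.comp
      (f := fun x : Fin 2 → Fin 2 → ℝ => (x i 0, x i 1))
      (((measurable_pi_apply 0).comp (measurable_pi_apply i)).prodMk
        ((measurable_pi_apply 1).comp (measurable_pi_apply i)))
  exact (h 0).prodMk (h 1)

/-- The set of pairs `(r, w)` with `0 < Im(r̄ w)`, `p (Im(r̄ w))`, `\overline{r/w} ∈ S` is measurable
for measurable `S` and `p`. [folklore] -/
theorem measurableSet_rowCone {S : Set UpperHalfPlane} (hS : MeasurableSet S) {p : ℝ → Prop}
    (hp : MeasurableSet {t | p t}) :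
    MeasurableSet {q : ℂ × ℂ | 0 < (conj q.1 * q.2).im ∧ p (conj q.1 * q.2).im ∧
      conj (q.1 / q.2) ∈ UpperHalfPlane.coe '' S} := by
  have hf : Measurable fun q : ℂ × ℂ => (conj q.1 * q.2).im :=
    Complex.measurable_im.comp ((Complex.continuous_conj.measurable.comp measurable_fst).mul
      measurable_snd)
  have hg : Measurable fun q : ℂ × ℂ => conj (q.1 / q.2) :=
    Complex.continuous_conj.measurable.comp (measurable_fst.div measurable_snd)
  refine (measurableSet_lt measurable_const hf).inter ((hf hp).inter ?_)
  exact hg (UpperHalfPlane.measurableEmbedding_coe.measurableSet_image.mpr hS)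

/-- **The cone over a measurable `S ⊆ ℍ` is Lebesgue measurable** (either with `det ≤ T` or
without). [folklore] -/
theorem measurableSet_cone {S : Set UpperHalfPlane} (hS : MeasurableSet S) {p : ℝ → Prop}
    (hp : MeasurableSet {t | p t}) {C : Set (Fin 2 → Fin 2 → ℝ)}
    (hC : ∀ x, x ∈ C ↔ ∃ g : GL (Fin 2) ℝ, (∀ i j, g i j = x i j) ∧ 0 < g.det.val ∧
      p g.det.val ∧ g • UpperHalfPlane.I ∈ S) :
    MeasurableSet C := by
  have : C = (fun x : Fin 2 → Fin 2 → ℝ => ((⟨x 0 0, x 0 1⟩ : ℂ), (⟨x 1 0, x 1 1⟩ : ℂ))) ⁻¹'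
      {q : ℂ × ℂ | 0 < (conj q.1 * q.2).im ∧ p (conj q.1 * q.2).im ∧
        conj (q.1 / q.2) ∈ UpperHalfPlane.coe '' S} := by
    ext x
    rw [hC x, exists_gl_entries_iff]
    rfl
  rw [this]
  exact measurable_rows (measurableSet_rowCone hS hp)

/-! ### 4. The cone volume -/

/-- The image `coe '' S ⊆ ℂ` of `S ⊆ ℍ`: membership. [folklore] -/
theorem mem_image_coe_iff {S : Set UpperHalfPlane} {z : ℂ} :
    z ∈ (UpperHalfPlane.coe '' S) ↔ ∃ h : 0 < z.im, (⟨z, h⟩ : UpperHalfPlane) ∈ S := by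
  constructor
  · rintro ⟨τ, hτ, rfl⟩
    exact ⟨τ.im_pos, hτ⟩
  · rintro ⟨h, hz⟩
    exact ⟨⟨z, h⟩, hz, rfl⟩

/-- The hyperbolic area as a Lebesgue integral of `(Im z)⁻²` over `coe '' S` (Mathlib
`UpperHalfPlane.volume_eq_lintegral`, with the density rewritten through `ENNReal.ofReal`). [folklore] -/
theorem volume_eq_lintegral_ofReal {S : Set UpperHalfPlane} (hS : MeasurableSet S) :
    volume S = ∫⁻ z in UpperHalfPlane.coe '' S, ENNReal.ofReal ((z.im ^ 2)⁻¹) := by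
  rw [UpperHalfPlane.volume_eq_lintegral]
  refine setLIntegral_congr_fun
    (UpperHalfPlane.measurableEmbedding_coe.measurableSet_image.mpr hS) fun z hz => ?_
  obtain ⟨him, -⟩ := mem_image_coe_iff.mp hz
  rw [← ENNReal.ofReal_coe_nnreal]
  congr 1
  rw [NNReal.coe_pow, NNReal.coe_div, NNReal.coe_one, coe_nnnorm, Real.norm_eq_abs,
    abs_of_pos him, one_div, inv_pow]

/-- For `w ≠ 0`: `\overline{r/w} · |w|² = r̄ w`. [folklore] -/
theorem conj_div_mul_normSq (r w : ℂ) (hw : w ≠ 0) :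
    conj (r / w) * (Complex.normSq w : ℂ) = conj r * w := by
  rw [map_div₀, Complex.normSq_eq_conj_mul_self]
  have : conj w ≠ 0 := (map_ne_zero _).mpr hw
  field_simp

/-- `Im(z · |w|²) = Im z · |w|²`. [folklore] -/
theorem im_mul_normSq (z w : ℂ) : (z * (Complex.normSq w : ℂ)).im = Complex.normSq w * z.im := by
  rw [Complex.mul_im, Complex.ofReal_re, Complex.ofReal_im, mul_zero, zero_add, mul_comm]

/-- **The section of the cone at a fixed second row `w`** has area `|w|² · Leb{z ∈ S : |w|² Im z ≤ T}`
(for `w ≠ 0` it is the image of that set under the `ℝ`-linear map `z ↦ w z̄` of determinant `-|w|²`;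
for `w = 0` both sides vanish). [folklore] -/
theorem volume_rowCone_section {S : Set UpperHalfPlane} (T : ℝ) (w : ℂ) :
    volume ((fun r : ℂ => (r, w)) ⁻¹'
      {q : ℂ × ℂ | 0 < (conj q.1 * q.2).im ∧ (conj q.1 * q.2).im ≤ T ∧
        conj (q.1 / q.2) ∈ UpperHalfPlane.coe '' S}) =
      ENNReal.ofReal (Complex.normSq w) *
        volume (UpperHalfPlane.coe '' S ∩ {z : ℂ | Complex.normSq w * z.im ≤ T}) := by
  by_cases hw : w = 0
  · subst hw
    have : ((fun r : ℂ => (r, (0:ℂ))) ⁻¹'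
        {q : ℂ × ℂ | 0 < (conj q.1 * q.2).im ∧ (conj q.1 * q.2).im ≤ T ∧
          conj (q.1 / q.2) ∈ UpperHalfPlane.coe '' S}) = ∅ := by
      ext r
      simp
    rw [this, measure_empty, map_zero, ENNReal.ofReal_zero, zero_mul]
  -- the linear map `z ↦ w z̄`
  let f : ℂ →ₗ[ℝ] ℂ := (Algebra.lmul ℝ ℂ w).comp Complex.conjAe.toLinearEquiv.toLinearMap
  have hf : ∀ z, f z = w * conj z := fun z => rfl
  have hdetf : LinearMap.det f = -Complex.normSq w := by
    rw [LinearMap.det_comp, Complex.det_conjAe, ← Algebra.norm_apply, Algebra.norm_complex_apply]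
    ring
  have hset : ((fun r : ℂ => (r, w)) ⁻¹'
      {q : ℂ × ℂ | 0 < (conj q.1 * q.2).im ∧ (conj q.1 * q.2).im ≤ T ∧
        conj (q.1 / q.2) ∈ UpperHalfPlane.coe '' S}) =
      f '' (UpperHalfPlane.coe '' S ∩ {z : ℂ | Complex.normSq w * z.im ≤ T}) := by
    ext r
    simp only [Set.mem_preimage, Set.mem_setOf_eq, Set.mem_image, Set.mem_inter_iff]
    constructor
    · rintro ⟨hpos, hle, hmem⟩
      have him : Complex.normSq w * (conj (r / w)).im = (conj r * w).im := by
        rw [← im_mul_normSq, conj_div_mul_normSq r w hw]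
      refine ⟨conj (r / w), ⟨hmem, ?_⟩, ?_⟩
      · rw [him]; exact hle
      · rw [hf, Complex.conj_conj]
        field_simp
    · rintro ⟨z, ⟨hz, hzle⟩, rfl⟩
      obtain ⟨hzim, -⟩ := mem_image_coe_iff.mp hz
      have hkey : conj (f z) * w = z * (Complex.normSq w : ℂ) := by
        rw [hf, map_mul, Complex.conj_conj, Complex.normSq_eq_conj_mul_self]; ring
      have hdiv : conj (f z / w) = z := by
        rw [hf, mul_div_cancel_left₀ _ hw, Complex.conj_conj]
      rw [hkey, im_mul_normSq, hdiv]
      exact ⟨mul_pos (Complex.normSq_pos.mpr hw) hzim, hzle, hz⟩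
  rw [hset, addHaar_image_linearMap, hdetf, abs_neg, abs_of_nonneg (Complex.normSq_nonneg w)]

/-- **The cone volume** (Vignéras IV §1; Shimizu §2): for a measurable `S ⊆ ℍ` and `T ≥ 0` the set
of real `2 × 2` matrices `x` with `0 < det x ≤ T` and `x • i ∈ S` has Lebesgue measure
`(π T² / 2) · μ(S)`, `μ` the hyperbolic measure `dx dy / y²`. The cone is described by the
hypothesis `hC`. [cite: VignerasLNM800, Ch. IV §1 and §3.A] -/
theorem volume_cone_eq {S : Set UpperHalfPlane} (hS : MeasurableSet S) {T : ℝ} (hT : 0 ≤ T)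
    {C : Set (Fin 2 → Fin 2 → ℝ)}
    (hC : ∀ x, x ∈ C ↔ ∃ g : GL (Fin 2) ℝ, (∀ i j, g i j = x i j) ∧ 0 < g.det.val ∧
      g.det.val ≤ T ∧ g • UpperHalfPlane.I ∈ S) :
    volume C = ENNReal.ofReal (π * T ^ 2 / 2) * volume S := by
  set Sc : Set ℂ := UpperHalfPlane.coe '' S with hSc
  have hScm : MeasurableSet Sc := UpperHalfPlane.measurableEmbedding_coe.measurableSet_image.mpr hS
  -- rows as complex numbers: a volume-preserving identification `M₂(ℝ) ≃ ℂ × ℂ`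
  let ρ : (Fin 2 → ℝ) ≃ᵐ ℂ := MeasurableEquiv.finTwoArrow.trans Complex.measurableEquivRealProd.symm
  have hρ : MeasurePreserving ρ :=
    (volume_preserving_finTwoArrow ℝ).trans Complex.volume_preserving_equiv_real_prod.symm
  let Φ : (Fin 2 → Fin 2 → ℝ) ≃ᵐ ℂ × ℂ :=
    MeasurableEquiv.finTwoArrow.trans (MeasurableEquiv.prodCongr ρ ρ)
  have hΦ : MeasurePreserving Φ := (volume_preserving_finTwoArrow (Fin 2 → ℝ)).trans (hρ.prod hρ)
  have hΦ_apply : ∀ x, Φ x = ((⟨x 0 0, x 0 1⟩ : ℂ), (⟨x 1 0, x 1 1⟩ : ℂ)) := fun x => rfl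
  -- the cone in these coordinates
  set C' : Set (ℂ × ℂ) := {q : ℂ × ℂ | 0 < (conj q.1 * q.2).im ∧ (conj q.1 * q.2).im ≤ T ∧
    conj (q.1 / q.2) ∈ Sc} with hC'
  have hC'm : MeasurableSet C' := measurableSet_rowCone hS (p := fun t => t ≤ T) measurableSet_Iic
  have hCC' : C = Φ ⁻¹' C' := by
    ext x
    exact (hC x).trans (exists_gl_entries_iff x (fun t => t ≤ T) S)
  rw [hCC', hΦ.measure_preimage hC'm.nullMeasurableSet, Measure.volume_eq_prod,
    Measure.prod_apply_symm hC'm]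
  have hsec : ∀ w : ℂ, volume ((fun r : ℂ => (r, w)) ⁻¹' C') = ENNReal.ofReal (Complex.normSq w) *
      volume (Sc ∩ {z : ℂ | Complex.normSq w * z.im ≤ T}) := fun w => volume_rowCone_section T w
  simp_rw [hsec]
  -- as a double integral of `G (w, z) = |w|² 𝟙{|w|² Im z ≤ T}` over `ℂ × Sc`
  set A : Set (ℂ × ℂ) := {q : ℂ × ℂ | Complex.normSq q.1 * q.2.im ≤ T} with hA
  have hAm : MeasurableSet A :=
    measurableSet_le ((Complex.continuous_normSq.measurable.comp measurable_fst).mul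
      (Complex.measurable_im.comp measurable_snd)) measurable_const
  set G : ℂ × ℂ → ℝ≥0∞ := fun q => ENNReal.ofReal (Complex.normSq q.1) * A.indicator 1 q with hG
  have hGm : Measurable G :=
    (ENNReal.measurable_ofReal.comp (Complex.continuous_normSq.measurable.comp measurable_fst)).mul
      (measurable_one.indicator hAm)
  have hvol : ∀ w : ℂ, ENNReal.ofReal (Complex.normSq w) *
      volume (Sc ∩ {z : ℂ | Complex.normSq w * z.im ≤ T}) = ∫⁻ z in Sc, G (w, z) := by
    intro w
    have h1 : volume (Sc ∩ {z : ℂ | Complex.normSq w * z.im ≤ T}) = ∫⁻ z in Sc, A.indicator 1 (w, z) := by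
      have : (fun z => A.indicator (1 : ℂ × ℂ → ℝ≥0∞) (w, z)) =
          {z : ℂ | Complex.normSq w * z.im ≤ T}.indicator 1 := by
        funext z
        simp only [hA, Set.indicator_apply, Set.mem_setOf_eq, Pi.one_apply]
      have hBm : MeasurableSet {z : ℂ | Complex.normSq w * z.im ≤ T} :=
        measurableSet_le (measurable_const.mul Complex.measurable_im) measurable_const
      rw [this, lintegral_indicator_one hBm, Measure.restrict_apply hBm, Set.inter_comm]
    rw [h1, ← lintegral_const_mul' _ _ ENNReal.ofReal_ne_top]
  simp_rw [hvol]
  rw [lintegral_lintegral_swap (hGm.aemeasurable (μ := volume.prod (volume.restrict Sc)))]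
  -- the inner integral
  have hinner : ∀ z ∈ Sc, ∫⁻ w, G (w, z) =
      ENNReal.ofReal (π * T ^ 2 / 2) * ENNReal.ofReal ((z.im ^ 2)⁻¹) := by
    intro z hz
    obtain ⟨hzim, -⟩ := mem_image_coe_iff.mp hz
    have hfun : (fun w => G (w, z)) = fun w =>
        {w : ℂ | Complex.normSq w * z.im ≤ T}.indicator (fun w => ENNReal.ofReal (Complex.normSq w)) w := by
      funext w
      simp only [hG, hA, Set.indicator_apply, Set.mem_setOf_eq, Pi.one_apply, mul_ite, mul_one,
        mul_zero]
    rw [hfun, lintegral_normSq_indicator z.im T hzim hT, ← ENNReal.ofReal_mul (by positivity)]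
    congr 1
    field_simp
  rw [setLIntegral_congr_fun hScm hinner, lintegral_const_mul' _ _ ENNReal.ofReal_ne_top,
    ← volume_eq_lintegral_ofReal hS]

/-- **A cone over a null set is null**: if `μ(S) = 0` then `{x : 0 < det x, x • i ∈ S}` is
Lebesgue-null in `M₂(ℝ)`. [folklore] -/
theorem volume_cone_eq_zero_of_null {S : Set UpperHalfPlane} (hS : MeasurableSet S)
    (h0 : volume S = 0) {C : Set (Fin 2 → Fin 2 → ℝ)}
    (hC : ∀ x, x ∈ C ↔ ∃ g : GL (Fin 2) ℝ, (∀ i j, g i j = x i j) ∧ 0 < g.det.val ∧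
      g • UpperHalfPlane.I ∈ S) :
    volume C = 0 := by
  have hsub : C ⊆ ⋃ n : ℕ, {x | ∃ g : GL (Fin 2) ℝ, (∀ i j, g i j = x i j) ∧ 0 < g.det.val ∧
      g.det.val ≤ n ∧ g • UpperHalfPlane.I ∈ S} := by
    intro x hx
    obtain ⟨g, hg, hdet, hmem⟩ := (hC x).mp hx
    obtain ⟨n, hn⟩ := exists_nat_ge g.det.val
    exact Set.mem_iUnion.mpr ⟨n, g, hg, hdet, hn, hmem⟩
  refine measure_mono_null hsub (measure_iUnion_null fun n => ?_)
  rw [volume_cone_eq hS (Nat.cast_nonneg n)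
    (C := {x | ∃ g : GL (Fin 2) ℝ, (∀ i j, g i j = x i j) ∧ 0 < g.det.val ∧
      g.det.val ≤ n ∧ g • UpperHalfPlane.I ∈ S}) (fun x => Iff.rfl), h0, mul_zero]

/-- **Scaling form**: the cone with `det ≤ T` has `T²` times the volume of the cone with `det ≤ 1`,
namely `(π/2) μ(S) T²` — the shape in which the count `#{α ∈ ι(O) : det ≤ T}` is compared with
`T²`. [folklore] -/
theorem volume_cone_one_eq {S : Set UpperHalfPlane} (hS : MeasurableSet S)
    {C : Set (Fin 2 → Fin 2 → ℝ)}
    (hC : ∀ x, x ∈ C ↔ ∃ g : GL (Fin 2) ℝ, (∀ i j, g i j = x i j) ∧ 0 < g.det.val ∧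
      g.det.val ≤ 1 ∧ g • UpperHalfPlane.I ∈ S) :
    volume C = ENNReal.ofReal (π / 2) * volume S := by
  rw [volume_cone_eq hS zero_le_one hC, one_pow, mul_one]

end Literature.NumberTheory.Automorphic

end
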